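import Mathlib
import Summits.Ventures.PercRepro2.SwOutCrossJunctionSwGN

/-!
# THEOREM A_cross FOR ANY CROSS GRAPH: the dropped vertices of a junction may form any simple
cross-edge graph (blind cell PercRepro2, night-4 g25, 2026-08-28; proofs/NIGHT4-G25.md §4‴)

A cross junction is re-indexed along a graph isomorphism of its cross graph without changing the
conclusion (`CrossJunction.reindex`: the dropped vertices are the same vertices of the graph, only
their index type changes), and every finite graph on a non-empty vertex type is isomorphic to the
nested disjoint union of its connected components (`sumG_iso`: the components `compOf C`, each a
`CompG` by `maximal_connected_induce_supp`, enumerated by `Finset.univ.toList`; the map `toX`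
is a bijection by the disjointness of the components and the nodup of the enumeration, and it
preserves adjacency because adjacent vertices lie in one component).  Hence
**`sw_of_crossJunction_any`**: row (SW) on every graph with a junction whose neighbours are
`h`-adjacent or dropped vertices forming ANY simple cross-edge graph — boundary (iv) of
Theorem A_mix at the class level, in full (one junction, simple cross edges, no pieces, the mark
not at a dropped vertex).
-/

namespace Summit.Ventures.PercRepro2

namespace CrossArm

open Hull LocRows

universe u uV

section Reindex

variable {V : Type uV} {E : Type*} {ends : E → Sym2 V} {X X' : Type*} {U : Set V} {h o u : V}
  {p : X → V} {G : SimpleGraph X} {G' : SimpleGraph X'}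

/-- **A cross junction re-indexed along a graph isomorphism of its cross graph.** -/
theorem CrossJunction.reindex (hj : CrossJunction ends U h u p G o) (φ : G' ≃g G) :
    CrossJunction ends U h u (p ∘ φ) G' o where
  hne_hu := hj.hne_hu
  hne_hp := fun i => hj.hne_hp (φ i)
  hne_up := fun i => hj.hne_up (φ i)
  p_inj := hj.p_inj.comp φ.injective
  hou := hj.hou
  hop := fun i => hj.hop (φ i)
  hhU := hj.hhU
  huU := hj.huU
  hpU := fun i => hj.hpU (φ i)
  hloop_h := hj.hloop_h
  hloop_u := hj.hloop_u
  hnadj := hj.hnadj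
  hnadj_p := fun i => hj.hnadj_p (φ i)
  hup := fun i => hj.hup (φ i)
  hcross := fun i j hij => hj.hcross (φ i) (φ j) (φ.map_adj_iff.2 hij)
  hcross_adj := fun i j e he => φ.map_adj_iff.1 (hj.hcross_adj (φ i) (φ j) e he)
  hcross_simple := fun i j e e' he he' => hj.hcross_simple (φ i) (φ j) e e' he he'
  hu_adj_h := fun e x he hx => hj.hu_adj_h e x he fun i hi => hx (φ.symm i) (by
    show x = p (φ (φ.symm i))
    rw [RelIso.apply_symm_apply]
    exact hi)
  hp_in := fun i e x he hxU => by
    rcases hj.hp_in (φ i) e x he hxU with h' | ⟨j, hj'⟩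
    · exact Or.inl h'
    · refine Or.inr ⟨φ.symm j, ?_⟩
      show x = p (φ (φ.symm j))
      rw [RelIso.apply_symm_apply]
      exact hj'
  hout := hj.hout

end Reindex

section Components

variable {X : Type u} (G : SimpleGraph X) [Fintype X] [DecidableEq X] [DecidableRel G.Adj]

open Classical

/-- A connected component of `G` as a component: its support with the induced graph. -/
noncomputable def compOf (C : G.ConnectedComponent) : CompG.{u} where
  X := ↥C.supp
  G := G.induce C.supp
  fX := inferInstance
  dX := inferInstance
  dG := inferInstance
  nX := ⟨⟨C.out, C.out_eq⟩⟩
  hG := (SimpleGraph.ConnectedComponent.maximal_connected_induce_supp C).1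

/-- The vertices of the nested sum of components, as vertices of `G`. -/
noncomputable def toX : ∀ (C : G.ConnectedComponent) (l : List G.ConnectedComponent),
    sumX (compOf G C) (l.map (compOf G)) → X
  | _, [], x => x.1
  | _, D :: l, x => Sum.elim (toX D l) (fun y => y.1) x

/-- The image of `toX` lies in the listed components. -/
lemma toX_mem : ∀ (C : G.ConnectedComponent) (l : List G.ConnectedComponent)
    (x : sumX (compOf G C) (l.map (compOf G))), G.connectedComponentMk (toX G C l x) ∈ C :: l
  | C, [], x => by
    simp only [List.mem_singleton]
    exact x.2
  | C, D :: l, x => by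
    rcases x with x | x
    · have := toX_mem D l x
      simp only [List.mem_cons] at this ⊢
      exact Or.inr this
    · simp only [List.mem_cons]
      exact Or.inl x.2

/-- `toX` is injective on a nodup enumeration. -/
lemma toX_injective : ∀ (C : G.ConnectedComponent) (l : List G.ConnectedComponent),
    (C :: l).Nodup → Function.Injective (toX G C l)
  | C, [], _, x, y, hxy => Subtype.ext hxy
  | C, D :: l, hnd, x, y, hxy => by
    have hnd' : (D :: l).Nodup := (List.nodup_cons.1 hnd).2
    have hC : C ∉ D :: l := (List.nodup_cons.1 hnd).1
    rcases x with x | x <;> rcases y with y | y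
    · exact congrArg Sum.inl (toX_injective D l hnd' hxy)
    · exfalso
      have h1 := toX_mem G D l x
      have h2 : G.connectedComponentMk y.1 = C := y.2
      have hxy' : toX G D l x = y.1 := hxy
      rw [hxy', h2] at h1
      exact hC h1
    · exfalso
      have h1 := toX_mem G D l y
      have h2 : G.connectedComponentMk x.1 = C := x.2
      have hxy' : x.1 = toX G D l y := hxy
      rw [← hxy', h2] at h1
      exact hC h1
    · exact congrArg Sum.inr (Subtype.ext hxy)

/-- Every vertex whose component is listed is hit by `toX`. -/
lemma toX_surj : ∀ (C : G.ConnectedComponent) (l : List G.ConnectedComponent) (x : X),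
    G.connectedComponentMk x ∈ C :: l → ∃ y, toX G C l y = x
  | C, [], x, hx => by
    simp only [List.mem_singleton] at hx
    exact ⟨⟨x, hx⟩, rfl⟩
  | C, D :: l, x, hx => by
    by_cases hxC : G.connectedComponentMk x = C
    · exact ⟨Sum.inr ⟨x, hxC⟩, rfl⟩
    · have hx' : G.connectedComponentMk x ∈ D :: l := by
        simp only [List.mem_cons] at hx ⊢
        rcases hx with h' | h' | h'
        · exact absurd h' hxC
        · exact Or.inl h'
        · exact Or.inr h'
      obtain ⟨y, hy⟩ := toX_surj D l x hx'
      exact ⟨Sum.inl y, hy⟩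

/-- `toX` is surjective on a complete enumeration. -/
lemma toX_surjective (C : G.ConnectedComponent) (l : List G.ConnectedComponent)
    (hall : ∀ D, D ∈ C :: l) : Function.Surjective (toX G C l) :=
  fun x => toX_surj G C l x (hall _)

/-- `toX` preserves adjacency on a nodup enumeration: the nested sum of the components is `G`. -/
lemma adj_toX : ∀ (C : G.ConnectedComponent) (l : List G.ConnectedComponent), (C :: l).Nodup →
    ∀ (x y : sumX (compOf G C) (l.map (compOf G))),
    (sumG (compOf G C) (l.map (compOf G))).Adj x y ↔ G.Adj (toX G C l x) (toX G C l y)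
  | C, [], _, x, y => by
    show (G.induce C.supp).Adj x y ↔ G.Adj x.1 y.1
    exact Iff.rfl
  | C, D :: l, hnd, x, y => by
    have hnd' : (D :: l).Nodup := (List.nodup_cons.1 hnd).2
    have hC : C ∉ D :: l := (List.nodup_cons.1 hnd).1
    rcases x with x | x <;> rcases y with y | y
    · show (sumG (compOf G D) (l.map (compOf G))).Adj x y ↔ G.Adj (toX G D l x) (toX G D l y)
      exact adj_toX D l hnd' x y
    · refine ⟨fun h => absurd h (SimpleGraph.not_adj_sum_inl_inr _ _), fun hadj => ?_⟩
      -- adjacent vertices lie in one component, but `C` is not a component of the tail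
      exfalso
      have h1 := toX_mem G D l x
      have h2 : G.connectedComponentMk y.1 = C := y.2
      have hadj' : G.Adj (toX G D l x) y.1 := hadj
      rw [SimpleGraph.ConnectedComponent.connectedComponentMk_eq_of_adj hadj', h2] at h1
      exact hC h1
    · refine ⟨fun h => absurd h.symm (SimpleGraph.not_adj_sum_inl_inr _ _), fun hadj => ?_⟩
      exfalso
      have h1 := toX_mem G D l y
      have h2 : G.connectedComponentMk x.1 = C := x.2
      have hadj' : G.Adj x.1 (toX G D l y) := hadj
      rw [← SimpleGraph.ConnectedComponent.connectedComponentMk_eq_of_adj hadj', h2] at h1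
      exact hC h1
    · show (G.induce C.supp).Adj x y ↔ G.Adj x.1 y.1
      exact Iff.rfl

/-- **The nested sum of the components of `G` is isomorphic to `G`** (a nodup, complete
enumeration of the components). -/
noncomputable def sumGIso (C : G.ConnectedComponent) (l : List G.ConnectedComponent)
    (hnd : (C :: l).Nodup) (hall : ∀ D, D ∈ C :: l) :
    sumG (compOf G C) (l.map (compOf G)) ≃g G where
  toEquiv := Equiv.ofBijective (toX G C l) ⟨toX_injective G C l hnd, toX_surjective G C l hall⟩
  map_rel_iff' := fun {x y} => (adj_toX G C l hnd x y).symm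

/-- **Every finite graph on a non-empty vertex type is the nested sum of its components.** -/
theorem exists_sumG_iso [Nonempty X] : ∃ (C : G.ConnectedComponent) (l : List G.ConnectedComponent),
    Nonempty (sumG (compOf G C) (l.map (compOf G)) ≃g G) := by
  obtain ⟨x₀⟩ := ‹Nonempty X›
  have hmem : G.connectedComponentMk x₀ ∈ (Finset.univ : Finset G.ConnectedComponent).toList :=
    Finset.mem_toList.2 (Finset.mem_univ _)
  obtain ⟨C, l, hl⟩ : ∃ C l, (Finset.univ : Finset G.ConnectedComponent).toList = C :: l := by
    rcases h : (Finset.univ : Finset G.ConnectedComponent).toList with _ | ⟨C, l⟩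
    · rw [h] at hmem
      exact absurd hmem (List.not_mem_nil)
    · exact ⟨C, l, rfl⟩
  have hnd : (C :: l).Nodup := hl ▸ Finset.nodup_toList _
  have hall : ∀ D, D ∈ C :: l := fun D => hl ▸ Finset.mem_toList.2 (Finset.mem_univ D)
  exact ⟨C, l, ⟨sumGIso G C l hnd hall⟩⟩

end Components

section Any

variable {V : Type uV} {E : Type*} [Fintype E] [DecidableEq E]

open scoped Classical

variable {ends : E → Sym2 V} {X : Type u} [Fintype X] [DecidableEq X] [Nonempty X]
  {G : SimpleGraph X} [DecidableRel G.Adj] {U : Set V} {l h o u : V} {p : X → V}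

/-- **THEOREM A_cross FOR ANY CROSS GRAPH: the rigid inequality on every class of a junction whose
dropped vertices form any simple cross-edge graph**, for every outside colouring. -/
theorem CrossJunction.rigidOK_of_crossJunction_any (hj : CrossJunction ends U h u p G o)
    (hl : l ∉ U) (ξ : Config E) : RigidOK ends l h o U ξ := by
  obtain ⟨C, l', ⟨φ⟩⟩ := exists_sumG_iso G
  exact (hj.reindex φ).rigidOK_of_crossJunctionN (compOf G C) (l'.map (compOf G)) hl ξ

/-- **Row 2′SW-ALL on every graph with a junction whose dropped vertices form any simple
cross-edge graph.** -/
theorem swAll_of_crossJunction_any (hlh : l ≠ h) (hj : CrossJunction ends ({l}ᶜ) h u p G o) :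
    SwAll ends l h o :=
  swAll_of_reducible l h o hlh (Reducible.base ends _ fun ξ =>
    hj.rigidOK_of_crossJunction_any (by simp) ξ)

/-- **Row (SW) on every graph with a junction whose dropped vertices form any simple cross-edge
graph** — boundary (iv) of Theorem A_mix at the class level, in full. -/
theorem sw_of_crossJunction_any (hlh : l ≠ h) (hj : CrossJunction ends ({l}ᶜ) h u p G o) :
    Sw ends l h o :=
  sw_of_swAll ends (swAll_of_crossJunction_any hlh hj)

end Any

end CrossArm

end Summit.Ventures.PercRepro2
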